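import Summits.RiemannHypothesis.RiemannHypothesis.Theorems.PfPersistenceEdgeLawLayer
import Summits.RiemannHypothesis.RiemannHypothesis.Theorems.PfPersistenceEdgeLawCutKernel

/-!
# Edge law — increments of a function Lipschitz in a monotone coordinate (RH-free)

Part of the pub-rhpf THEORY-2 programme (mechanism / rigidity of the Weil window bottom; no RH
claims). Abstract `L²` bookkeeping used to show that the interior dilation defect of a Weil
ground state is `o(η)` (`PfPersistenceEdgeLawCuspDefect`):

* `integral_shift_sub_le`: for `Θ` monotone on `[α, β + s]`,
  `∫_α^β (Θ(x + s) − Θ(x)) dx ≤ s (Θ(β + s) − Θ(α))`;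
* `weilIncrement_le_of_lipschitzCoord`: if `t` vanishes off `[-b, b]`, `‖t(±b)‖ ≤ J`, and
  `‖t(y) − t(x)‖ ≤ C (Θ(y) − Θ(x))` for `−b ≤ x ≤ y ≤ b` with `Θ` monotone of modulus `ω` at scale
  `s`, then `D_s(t) ≤ s (C² ω (Θ(b) − Θ(−b)) + 2 (C ω + J)²)`;
* `setIntegral_arch_near_le`: `∫_{(0,h]} ρ D_·(t) ≤ h (1/2 + h) Φ` when `D_s(t) ≤ s Φ` on `(0, h]`;
* `windowDefectForm_le_near_add`: for `σ ∈ L²` vanishing off the window, `‖σ‖² = m`,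
  `D_a(σ) ≤ ∫_{(0,h]} ρ D_·(σ) + (2 log(1/h) + 2 K_a) m` (`K_a = layerConstant a`).

Sources: E. Bombieri, *Remarks on Weil's quadratic functional in the theory of prime numbers I*,
Rend. Mat. Acc. Lincei (9) 11 (2000) §4 Thm 3 (the closed form of the energy on a window).
-/

set_option linter.dupNamespace false

noncomputable section

open MeasureTheory Set Filter
open scoped Topology ENNReal

namespace Summit.RiemannHypothesis.RiemannHypothesis.Theorems.PfPersistence

open Literature.NumberTheory.LFunctions
open Summit.RiemannHypothesis.RiemannHypothesis.Theorems.WeilWindowFlowWindowLipschitz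

variable {a : ℝ}

/-! ## Shift integrals of a monotone function -/

/-- For `Θ` monotone on `[α, β + s]` (`α ≤ β`, `0 ≤ s`):
`∫_α^β (Θ(x+s) − Θ(x)) dx ≤ s (Θ(β+s) − Θ(α))` (the shifted integral telescopes to
`∫_β^{β+s} Θ − ∫_α^{α+s} Θ`). [folklore] -/
theorem integral_shift_sub_le {Θ : ℝ → ℝ} {α β s : ℝ} (hαβ : α ≤ β) (hs : 0 ≤ s)
    (hΘ : MonotoneOn Θ (Icc α (β + s))) :
    ∫ x in α..β, (Θ (x + s) - Θ x) ≤ s * (Θ (β + s) - Θ α) := by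
  have hii : ∀ c d, α ≤ c → c ≤ d → d ≤ β + s → IntervalIntegrable Θ volume c d :=
    fun c d hc hcd hd ↦ (hΘ.mono (by rw [uIcc_of_le hcd]; exact Icc_subset_Icc hc hd))
      |>.intervalIntegrable
  have hshift : ∫ x in α..β, Θ (x + s) = ∫ x in (α + s)..(β + s), Θ x :=
    intervalIntegral.integral_comp_add_right Θ s
  have hΘs : IntervalIntegrable (fun x ↦ Θ (x + s)) volume α β := by
    have hm : MonotoneOn (fun x ↦ Θ (x + s)) (uIcc α β) := by
      rw [uIcc_of_le hαβ]
      intro x hx y hy hxy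
      exact hΘ ⟨by linarith [hx.1], by linarith [hx.2]⟩ ⟨by linarith [hy.1], by linarith [hy.2]⟩
        (by linarith)
    exact hm.intervalIntegrable
  rw [intervalIntegral.integral_sub hΘs (hii α β le_rfl hαβ (by linarith)), hshift]
  have h1 := intervalIntegral.integral_add_adjacent_intervals (hii α β le_rfl hαβ (by linarith))
    (hii β (β + s) hαβ (by linarith) le_rfl)
  have h2 := intervalIntegral.integral_add_adjacent_intervals
    (hii α (α + s) le_rfl (by linarith) (by linarith))
    (hii (α + s) (β + s) (by linarith) (by linarith) le_rfl)
  have htop : ∫ x in β..(β + s), Θ x ≤ s * Θ (β + s) := by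
    have := intervalIntegral.integral_mono_on (by linarith : β ≤ β + s)
      (hii β (β + s) hαβ (by linarith) le_rfl) intervalIntegrable_const
      (g := fun _ ↦ Θ (β + s)) fun x hx ↦ hΘ ⟨by linarith [hx.1], hx.2⟩
        ⟨by linarith, le_rfl⟩ hx.2
    rw [intervalIntegral.integral_const, smul_eq_mul] at this
    linarith
  have hbot : s * Θ α ≤ ∫ x in α..(α + s), Θ x := by
    have := intervalIntegral.integral_mono_on (by linarith : α ≤ α + s)
      intervalIntegrable_const (hii α (α + s) le_rfl (by linarith) (by linarith))
      (f := fun _ ↦ Θ α) fun x hx ↦ hΘ ⟨le_rfl, by linarith⟩ ⟨hx.1, by linarith [hx.2]⟩ hx.1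
    rw [intervalIntegral.integral_const, smul_eq_mul] at this
    linarith
  linarith

/-! ## Increments of a function Lipschitz in a monotone coordinate -/

/-- **Increment bound for a function Lipschitz in a monotone coordinate.** Let `t` vanish off
`[-b, b]`, `‖t(b)‖, ‖t(−b)‖ ≤ J`, and `‖t(y) − t(x)‖ ≤ C (Θ(y) − Θ(x))` for `−b ≤ x ≤ y ≤ b`
with `Θ` monotone on `[-b, b]` and `Θ(y) − Θ(x) ≤ ω` whenever moreover `y ≤ x + s`
(`0 < s ≤ 2b`). Then `D_s(t) ≤ s (C² ω (Θ(b) − Θ(−b)) + 2 (C ω + J)²)`: interior pairs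
contribute `C² ω ∫ (Θ(x+s) − Θ(x)) ≤ C² ω s (Θ(b) − Θ(−b))`, the two straddling strips of
width `s` at most `(C ω + J)²` each per unit length. [folklore] -/
theorem weilIncrement_le_of_lipschitzCoord {t : ℝ → ℂ} {b C J s ω : ℝ} {Θ : ℝ → ℝ}
    (hs : 0 < s) (hsb : s ≤ 2 * b) (hC : 0 ≤ C)
    (hts : ∀ x, x ∉ Icc (-b) b → t x = 0) (hΘ : MonotoneOn Θ (Icc (-b) b))
    (hlip : ∀ x ∈ Icc (-b) b, ∀ y ∈ Icc (-b) b, x ≤ y → ‖t y - t x‖ ≤ C * (Θ y - Θ x))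
    (hωs : ∀ x ∈ Icc (-b) b, ∀ y ∈ Icc (-b) b, x ≤ y → y ≤ x + s → Θ y - Θ x ≤ ω)
    (hJb : ‖t b‖ ≤ J) (hJb' : ‖t (-b)‖ ≤ J) :
    weilIncrement t s ≤ s * (C ^ 2 * ω * (Θ b - Θ (-b)) + 2 * (C * ω + J) ^ 2) := by
  have hb : 0 < b := by linarith
  have hω : 0 ≤ ω := by
    have := hωs b ⟨by linarith, le_rfl⟩ b ⟨by linarith, le_rfl⟩ le_rfl (by linarith)
    simpa using this
  -- the three majorants
  set F₁ : ℝ → ℝ := (Icc (-b) (b - s)).indicator fun x ↦ C ^ 2 * ω * (Θ (x + s) - Θ x) with hF₁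
  set F₂ : ℝ → ℝ := (Ioc (b - s) b).indicator fun _ ↦ (C * ω + J) ^ 2 with hF₂
  set F₃ : ℝ → ℝ := (Ico (-b - s) (-b)).indicator fun _ ↦ (C * ω + J) ^ 2 with hF₃
  have hF₁0 : ∀ x, 0 ≤ F₁ x := fun x ↦ by
    simp only [hF₁]
    refine Set.indicator_nonneg (fun y hy ↦ ?_) x
    exact mul_nonneg (by positivity) (sub_nonneg.2 (hΘ ⟨hy.1, by linarith [hy.2]⟩
      ⟨by linarith [hy.1], by linarith [hy.2]⟩ (by linarith)))
  have hF₂0 : ∀ x, 0 ≤ F₂ x := fun x ↦ by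
    simp only [hF₂]
    exact Set.indicator_nonneg (fun _ _ ↦ by positivity) x
  have hF₃0 : ∀ x, 0 ≤ F₃ x := fun x ↦ by
    simp only [hF₃]
    exact Set.indicator_nonneg (fun _ _ ↦ by positivity) x
  -- pointwise majorisation
  have hpt : ∀ x, ‖t (x + s) - t x‖ ^ 2 ≤ F₁ x + F₂ x + F₃ x := by
    intro x
    by_cases hx : x ∈ Icc (-b) b
    · by_cases hxs : x ≤ b - s
      · -- interior pair
        have hxs' : x + s ∈ Icc (-b) b := ⟨by linarith [hx.1], by linarith⟩
        have hΔ0 : 0 ≤ Θ (x + s) - Θ x := sub_nonneg.2 (hΘ hx hxs' (by linarith))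
        have hΔω : Θ (x + s) - Θ x ≤ ω := hωs x hx (x + s) hxs' (by linarith) le_rfl
        have h1 := hlip x hx (x + s) hxs' (by linarith)
        have h2 : ‖t (x + s) - t x‖ ^ 2 ≤ (C * (Θ (x + s) - Θ x)) ^ 2 :=
          pow_le_pow_left₀ (norm_nonneg _) h1 2
        have h3 : (C * (Θ (x + s) - Θ x)) ^ 2 ≤ C ^ 2 * ω * (Θ (x + s) - Θ x) := by
          rw [mul_pow]
          have := mul_le_mul_of_nonneg_left hΔω hΔ0
          nlinarith [sq_nonneg C]
        have hF : F₁ x = C ^ 2 * ω * (Θ (x + s) - Θ x) := by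
          have hm : x ∈ Icc (-b) (b - s) := ⟨hx.1, hxs⟩
          simp only [hF₁, Set.indicator_of_mem hm]
        linarith [hF₂0 x, hF₃0 x]
      · -- right straddling strip: `t(x + s) = 0`
        rw [not_le] at hxs
        have h0 : t (x + s) = 0 := hts _ fun h ↦ by linarith [h.2]
        have h1 := hlip x hx b ⟨by linarith, le_rfl⟩ hx.2
        have h2 := hωs x hx b ⟨by linarith, le_rfl⟩ hx.2 (by linarith)
        have h3 : ‖t x‖ ≤ C * ω + J := by
          have := norm_sub_le_norm_sub_add_norm_sub (t x) (t b) 0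
          rw [sub_zero, sub_zero, norm_sub_rev] at this
          nlinarith [mul_le_mul_of_nonneg_left h2 hC]
        have hF : F₂ x = (C * ω + J) ^ 2 := by
          have hm : x ∈ Ioc (b - s) b := ⟨hxs, hx.2⟩
          simp only [hF₂, Set.indicator_of_mem hm]
        rw [h0, zero_sub, norm_neg]
        have h4 : ‖t x‖ ^ 2 ≤ (C * ω + J) ^ 2 := pow_le_pow_left₀ (norm_nonneg _) h3 2
        linarith [hF₁0 x, hF₃0 x]
    · have h0 : t x = 0 := hts x hx
      by_cases hxs : x + s ∈ Icc (-b) b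
      · -- left straddling strip: `t x = 0`
        have hxlt : x < -b := by
          by_contra h
          exact hx ⟨not_lt.1 h, by linarith [hxs.2]⟩
        have h1 := hlip (-b) ⟨le_rfl, by linarith⟩ (x + s) hxs hxs.1
        have h2 := hωs (-b) ⟨le_rfl, by linarith⟩ (x + s) hxs hxs.1 (by linarith)
        have h3 : ‖t (x + s)‖ ≤ C * ω + J := by
          have := norm_sub_le_norm_sub_add_norm_sub (t (x + s)) (t (-b)) 0
          rw [sub_zero, sub_zero] at this
          nlinarith [mul_le_mul_of_nonneg_left h2 hC]
        have hF : F₃ x = (C * ω + J) ^ 2 := by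
          have hm : x ∈ Ico (-b - s) (-b) := ⟨by linarith [hxs.1], hxlt⟩
          simp only [hF₃, Set.indicator_of_mem hm]
        rw [h0, sub_zero]
        have h4 : ‖t (x + s)‖ ^ 2 ≤ (C * ω + J) ^ 2 := pow_le_pow_left₀ (norm_nonneg _) h3 2
        linarith [hF₁0 x, hF₂0 x]
      · rw [h0, hts _ hxs, sub_zero, norm_zero, zero_pow two_ne_zero]
        linarith [hF₁0 x, hF₂0 x, hF₃0 x]
  -- integrability of the majorants
  have hΘi : IntegrableOn (fun x ↦ C ^ 2 * ω * (Θ (x + s) - Θ x)) (Icc (-b) (b - s)) := by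
    have hαβ : -b ≤ b - s := by linarith
    have hm1 : MonotoneOn (fun x ↦ Θ (x + s)) (uIcc (-b) (b - s)) := by
      rw [uIcc_of_le hαβ]
      intro x hx y hy hxy
      exact hΘ ⟨by linarith [hx.1], by linarith [hx.2]⟩ ⟨by linarith [hy.1], by linarith [hy.2]⟩
        (by linarith)
    have hm2 : MonotoneOn Θ (uIcc (-b) (b - s)) := by
      rw [uIcc_of_le hαβ]
      exact hΘ.mono (Icc_subset_Icc_right (by linarith))
    have hi := ((hm1.intervalIntegrable (μ := volume)).sub hm2.intervalIntegrable).const_mul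
      (C ^ 2 * ω)
    rw [intervalIntegrable_iff_integrableOn_Icc_of_le hαβ] at hi
    exact hi
  have hI₁ : Integrable F₁ := hΘi.integrable_indicator measurableSet_Icc
  have hI₂ : Integrable F₂ :=
    (integrableOn_const (by rw [Real.volume_Ioc]; exact ENNReal.ofReal_ne_top)
      (C := (C * ω + J) ^ 2)).integrable_indicator measurableSet_Ioc
  have hI₃ : Integrable F₃ :=
    (integrableOn_const (by rw [Real.volume_Ico]; exact ENNReal.ofReal_ne_top)
      (C := (C * ω + J) ^ 2)).integrable_indicator measurableSet_Ico
  -- the integrals of the majorants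
  have hint₁ : ∫ x, F₁ x ≤ C ^ 2 * ω * (s * (Θ b - Θ (-b))) := by
    rw [hF₁, integral_indicator measurableSet_Icc, integral_const_mul,
      integral_Icc_eq_integral_Ioc, ← intervalIntegral.integral_of_le (by linarith : -b ≤ b - s)]
    refine mul_le_mul_of_nonneg_left ?_ (by positivity)
    have h := integral_shift_sub_le (by linarith : -b ≤ b - s) hs.le
      (Θ := Θ) (by rw [show b - s + s = b by ring]; exact hΘ)
    rw [show b - s + s = b by ring] at h
    exact h
  have hint₂ : ∫ x, F₂ x = s * (C * ω + J) ^ 2 := by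
    rw [hF₂, integral_indicator_const _ measurableSet_Ioc,
      Real.volume_real_Ioc_of_le (by linarith), smul_eq_mul]
    ring
  have hint₃ : ∫ x, F₃ x = s * (C * ω + J) ^ 2 := by
    rw [hF₃, integral_indicator_const _ measurableSet_Ico,
      Real.volume_real_Ico_of_le (by linarith), smul_eq_mul]
    ring
  -- assemble
  unfold weilIncrement
  calc ∫ x, ‖t (x + s) - t x‖ ^ 2 ≤ ∫ x, (F₁ x + F₂ x + F₃ x) :=
        integral_mono_of_nonneg (ae_of_all _ fun x ↦ by positivity) ((hI₁.add hI₂).add hI₃)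
          (ae_of_all _ hpt)
    _ = (∫ x, F₁ x) + (∫ x, F₂ x) + ∫ x, F₃ x := by
        rw [integral_add (f := fun x ↦ F₁ x + F₂ x) (g := F₃) (hI₁.add hI₂) hI₃,
          integral_add (f := F₁) (g := F₂) hI₁ hI₂]
    _ ≤ s * (C ^ 2 * ω * (Θ b - Θ (-b)) + 2 * (C * ω + J) ^ 2) := by
        rw [hint₂, hint₃]
        nlinarith [hint₁]

/-! ## The near part of the archimedean energy -/

/-- If `D_s(t) ≤ s Φ` for `0 < s ≤ h ≤ 1` then `∫_{(0,h]} ρ(s) D_s(t) ds ≤ h (1/2 + h) Φ`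
(`ρ(s) ≤ 1/(2s) + 1` on `(0, 1]`). [folklore] -/
theorem setIntegral_arch_near_le {t : ℝ → ℂ} {h Φ : ℝ} (hh : 0 < h) (hh1 : h ≤ 1) (hΦ : 0 ≤ Φ)
    (hD : ∀ s, 0 < s → s ≤ h → weilIncrement t s ≤ s * Φ)
    (hfin : IntegrableOn (fun s ↦ weilArchDensity s * weilIncrement t s) (Ioc 0 h)) :
    ∫ s in Ioc 0 h, weilArchDensity s * weilIncrement t s ≤ h * (1 / 2 + h) * Φ := by
  have hpt : ∀ s ∈ Ioc 0 h, weilArchDensity s * weilIncrement t s ≤ (1 / 2 + h) * Φ := by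
    intro s hs
    have hs0 : 0 < s := hs.1
    have hρ := weilArchDensity_le_half_inv_add_one hs.1 (hs.2.trans hh1)
    calc weilArchDensity s * weilIncrement t s ≤ (1 / (2 * s) + 1) * (s * Φ) :=
          mul_le_mul hρ (hD s hs.1 hs.2) (weilIncrement_nonneg _ _) (by positivity)
      _ = (1 / 2 + s) * Φ := by field_simp
      _ ≤ (1 / 2 + h) * Φ := mul_le_mul_of_nonneg_right (by linarith [hs.2]) hΦ
  calc ∫ s in Ioc 0 h, weilArchDensity s * weilIncrement t s
      ≤ ∫ s in Ioc 0 h, (1 / 2 + h) * Φ :=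
        setIntegral_mono_on hfin (integrableOn_const (by rw [Real.volume_Ioc]; exact
          ENNReal.ofReal_ne_top)) measurableSet_Ioc hpt
    _ = h * (1 / 2 + h) * Φ := by
        rw [setIntegral_const, Real.volume_real_Ioc_of_le hh.le, sub_zero, smul_eq_mul]
        ring

/-! ## Energy bookkeeping: near part plus `L²` terms -/

/-- `0 ≤ C_a^P`. [folklore] -/
theorem windowPoleConstant_nonneg (a : ℝ) : 0 ≤ windowPoleConstant a := by
  unfold windowPoleConstant
  have h1 : 0 ≤ ∫ x in Icc (-a) a, Real.cosh (x / 2) ^ 2 :=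
    setIntegral_nonneg measurableSet_Icc fun x _ ↦ sq_nonneg _
  have h2 : 0 ≤ ∫ x in Icc (-a) a, Real.sinh (x / 2) ^ 2 :=
    setIntegral_nonneg measurableSet_Icc fun x _ ↦ sq_nonneg _
  linarith

/-- **Energy bookkeeping (upper bound).** For `σ ∈ L²` vanishing on `|x| ≥ a` with `‖σ‖² = m`
and finite energy, and `0 < h ≤ min a 1 / 2`:
`D_a(σ) ≤ ∫_{(0,h]} ρ D_·(σ) + (2 log(1/h) + 2 K_a) m` — middle range `D_t ≤ 4m` against the
Coulomb count `∫_{(h,T₀]} ρ ≤ ½ log(T₀/h) + T₀`, tail, primes, pole and Markov shift `O(m)`.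
[cite: Bombieri2000Weil, §4 Thm 3] -/
theorem windowDefectForm_le_near_add (ha : 0 < a) {σ : ℝ → ℂ} {m h : ℝ}
    (hσ2 : MemLp σ 2) (hσs : ∀ x, a ≤ |x| → σ x = 0) (hm2 : ∫ x, ‖σ x‖ ^ 2 = m)
    (hh : 0 < h) (hhT : h ≤ min a 1 / 2)
    (hfin : IntegrableOn (fun t ↦ weilArchDensity t * weilIncrement σ t) (Ioi 0)) :
    windowDefectForm a σ ≤
      (∫ t in Ioc 0 h, weilArchDensity t * weilIncrement σ t) +
        (2 * Real.log (1 / h) + 2 * layerConstant a) * m := by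
  have hT0 : 0 < min a 1 := lt_min ha one_pos
  have hT1 : min a 1 ≤ 1 := min_le_right _ _
  have hhT' : h ≤ min a 1 := by linarith
  have hm0 : 0 ≤ m := hm2 ▸ integral_nonneg fun _ ↦ by positivity
  have hF0 : ∀ t, 0 < t → 0 ≤ weilArchDensity t * weilIncrement σ t := fun t ht ↦
    mul_nonneg (weilArchDensity_pos ht).le (weilIncrement_nonneg _ _)
  have hF4 : ∀ t, 0 < t → weilArchDensity t * weilIncrement σ t ≤ weilArchDensity t * (4 * m) :=
    fun t ht ↦ by
    rw [← hm2]
    exact mul_le_mul_of_nonneg_left (stub_barrierEnergy_weilIncrement_le_four hσ2 t)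
      (weilArchDensity_pos ht).le
  -- splitting `Ioi 0 = Ioc 0 h ∪ Ioc h T₀ ∪ Ioi T₀`
  have hd1 : Disjoint (Ioc 0 h) (Ioi h) := disjoint_left.2 fun t ht ht' ↦ (not_lt.2 ht.2) ht'
  have hd2 : Disjoint (Ioc h (min a 1)) (Ioi (min a 1)) :=
    disjoint_left.2 fun t ht ht' ↦ (not_lt.2 ht.2) ht'
  have hsplit : ∫ t in Ioi 0, weilArchDensity t * weilIncrement σ t =
      (∫ t in Ioc 0 h, weilArchDensity t * weilIncrement σ t) +
      (∫ t in Ioc h (min a 1), weilArchDensity t * weilIncrement σ t) +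
      ∫ t in Ioi (min a 1), weilArchDensity t * weilIncrement σ t := by
    rw [← Ioc_union_Ioi_eq_Ioi hh.le, setIntegral_union hd1 measurableSet_Ioi
      (hfin.mono_set Ioc_subset_Ioi_self) (hfin.mono_set (Ioi_subset_Ioi hh.le)),
      ← Ioc_union_Ioi_eq_Ioi hhT', setIntegral_union hd2 measurableSet_Ioi
      (hfin.mono_set fun t ht ↦ (hh.trans ht.1 : 0 < t))
      (hfin.mono_set (Ioi_subset_Ioi hT0.le)), add_assoc]
  -- middle range: `D_t ≤ 4m`
  have hρmid : IntegrableOn weilArchDensity (Ioc h (min a 1)) :=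
    (integrableOn_weilArchDensity_Ioi hh).mono_set Ioc_subset_Ioi_self
  have hmid : ∫ t in Ioc h (min a 1), weilArchDensity t * weilIncrement σ t ≤
      4 * m * ∫ t in Ioc h (min a 1), weilArchDensity t := by
    calc ∫ t in Ioc h (min a 1), weilArchDensity t * weilIncrement σ t
        ≤ ∫ t in Ioc h (min a 1), weilArchDensity t * (4 * m) :=
          setIntegral_mono_on (hfin.mono_set fun t ht ↦ (hh.trans ht.1 : 0 < t))
            (hρmid.mul_const _) measurableSet_Ioc fun t ht ↦ hF4 t (hh.trans ht.1)
      _ = 4 * m * ∫ t in Ioc h (min a 1), weilArchDensity t := by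
          rw [integral_mul_const]; ring
  -- Coulomb count, with `log(T₀/h) = log T₀ + log(1/h)`
  have hcoul := abs_integral_weilArchDensity_sub_log_le hh hhT' hT1
  rw [Real.log_div hT0.ne' hh.ne', show Real.log h = -Real.log (1 / h) by
    rw [one_div, Real.log_inv, neg_neg], abs_le] at hcoul
  obtain ⟨-, hc2⟩ := hcoul
  have hc2' := mul_le_mul_of_nonneg_left hc2 (by positivity : (0 : ℝ) ≤ 4 * m)
  have hl1 := mul_le_mul_of_nonneg_left (le_abs_self (Real.log (min a 1))) hm0
  -- tail
  have htail : ∫ t in Ioi (min a 1), weilArchDensity t * weilIncrement σ t ≤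
      4 * m * ∫ t in Ioi (min a 1), weilArchDensity t := by
    calc ∫ t in Ioi (min a 1), weilArchDensity t * weilIncrement σ t
        ≤ ∫ t in Ioi (min a 1), weilArchDensity t * (4 * m) :=
          setIntegral_mono_on (hfin.mono_set (Ioi_subset_Ioi hT0.le))
            ((integrableOn_weilArchDensity_Ioi hT0).mul_const _) measurableSet_Ioi
            fun t ht ↦ hF4 t (hT0.trans ht)
      _ = 4 * m * ∫ t in Ioi (min a 1), weilArchDensity t := by
          rw [integral_mul_const]; ring
  have hCρ0 : 0 ≤ ∫ t in Ioi (min a 1), weilArchDensity t :=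
    setIntegral_nonneg measurableSet_Ioi fun t ht ↦ (weilArchDensity_pos (hT0.trans ht)).le
  -- primes, pole, Markov shift
  obtain ⟨-, hP4⟩ := prime_sum_weilIncrement_le hσ2 a
  rw [hm2] at hP4
  have hpole := abs_weilPoleForm_le_window hσ2 hσs
  rw [hm2, abs_le] at hpole
  obtain ⟨-, hp2⟩ := hpole
  have hM2 := mul_le_mul_of_nonneg_left (neg_abs_le (weilMarkovConstant a + weilGroundEnergy a)) hm0
  have hS0 : 0 ≤ ∑ n ∈ weilPrimeIndex a, (ArithmeticFunction.vonMangoldt n : ℝ) / Real.sqrt n :=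
    Finset.sum_nonneg fun n _ ↦ div_nonneg ArithmeticFunction.vonMangoldt_nonneg (Real.sqrt_nonneg _)
  have hCP0 := windowPoleConstant_nonneg a
  -- assemble
  have hD : windowDefectForm a σ = weilPoleForm σ +
      ((∑ n ∈ weilPrimeIndex a, (ArithmeticFunction.vonMangoldt n : ℝ) / Real.sqrt n *
          weilIncrement σ (Real.log n)) +
        ∫ t in Ioi 0, weilArchDensity t * weilIncrement σ t) -
      (weilMarkovConstant a + weilGroundEnergy a) * m := by
    rw [windowDefectForm, weilDirichletEnergy, hm2]
  rw [hD, hsplit, layerConstant]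
  nlinarith [mul_nonneg hm0 hT0.le, mul_nonneg hm0 hCρ0, mul_nonneg hm0 hS0, mul_nonneg hm0 hCP0,
    abs_nonneg (Real.log (min a 1)), abs_nonneg (weilMarkovConstant a + weilGroundEnergy a),
    mul_nonneg hm0 (abs_nonneg (weilMarkovConstant a + weilGroundEnergy a)),
    mul_nonneg hm0 (abs_nonneg (Real.log (min a 1)))]

end Summit.RiemannHypothesis.RiemannHypothesis.Theorems.PfPersistence

end
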